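import Literature.NumberTheory.Automorphic.Liu2021.Sec41MotivesCMCharacters
import Literature.NumberTheory.Automorphic.Liu2021.Thm418AsPrinted
import Mathlib.RepresentationTheory.Invariants
import Mathlib.RepresentationTheory.Irreducible
import HarnessLib

/-!
# [Liu 2021] §4.3 «Construction of Fourier–Jacobi cycles» (Camb. J. Math. 9, pp. 57–63) — section carpet, items 4.24–4.30

Y. Liu, *Fourier–Jacobi cycles and arithmetic relative trace formula*, Cambridge J. Math. **9** (2021), no. 1, 1–147
= arXiv:2102.11518 [Liu2021]; §4.3 = print p. 57 L1 – p. 63 L3 (TeX `FJcycle.tex`, md5 `6db49a74122d…`, ll. 2393–2618).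
Page pins from the held journal text `paper:liu2021-fourier-jacobi-cycles-arithmetic-relative-trace-formula` (pNNNN = journal
page N); numbering = journal = arXiv.  STATEMENTS ONLY (carpet-typing, squad TL «Liu FJ∕418», seat TL-t01, second block, §4.3
only — §4.4 is TL-t02's `Sec44ArithmeticGGP`): no proof, no `sorry`, no `axiom`, no `instance`, no notation.  Dedup
census (2026-09-02): no tree file carries `[cite: Liu2021, <item>]` for any item 4.24–4.30 (Prop. 4.25 is mentioned twice
inside `Automorphic/Arthur2013/Downstream*` as a downstream use of [Art13], not stated).

## INDEX (item ↦ declaration; namespace `Literature.NumberTheory.Automorphic.Liu2021.Sec43FourierJacobiCycles`)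

| item (print page; TeX lines) | declaration(s) | kind |
|---|---|---|
| §4.3 preamble (p. 57; ll. 2397–2418): level subgroups, `𝓗_R`, `L_g`, `R_g`, `𝓗_{K,R}`, `𝕋_K`, `vol(K)` | `IsBiInvariant`, `HasFiniteDoubleCosetSupport`, `MemHecke`, `leftTranslate`, `rightTranslate`, `indicatorFun`, `ShimuraData` (fields `IsLevel`, `vol`, `numComp`, `conv`, `CHXX`, `T`, `diag`, …), `ShimuraData.inclL`, `ShimuraData.MemFullHecke`, `ShimuraData.HeckeMapAlgHom` (fact: «`𝕋_K` is a homomorphism of `R`-algebras», «`𝕋_K^{𝟙_K} = vol(K)·Δ`») | REAL defs + ⟨CARRIER⟩ + fact |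
| Def. 4.24 (pp. 57–58; l. 2421) `Φ_Π` | `ShimuraData.AppearsIn`, `ShimuraData.IsAdmissibleRep`, `ShimuraData.MemPhi` | DEFINED |
| Prop. 4.25 (p. 58; l. 2436) | `ShimuraData.AppearsSemisimply`, `ShimuraData.AppearsInMod`, `ShimuraData.Prop425AsPrinted` | fact |
| Def. 4.26 (p. 58; l. 2459) test function; «notation as above» (p. 58 last par., Prop. 4.27) | `ShimuraData.IsDualPair`, `ShimuraData.IsTestFunction`, `ShimuraData.NotationAsAbove` | DEFINED |
| Steps 1–3, `FJ(f₁,f₂;φ)_K` (pp. 59–60; ll. 2471–2501); `CH^i(…)^♮_L[i_μ]` (p. 60; l. 2504) | `CycleData` (fields `CH3`, `CH3zero`, `CH3nat`, `toNat`, `actM`, `IsIntegralHom`, `step2`, `corrPull`, …), `CycleData.FJ`, `CycleData.natIota` | ⟨CARRIER⟩ + DEFINED |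
| Prop. 4.27 (p. 60; l. 2507) | `ShimuraData.HomEquivTT`, `CycleData.Prop427_1AsPrinted`, `CycleData.Prop427_2AsPrinted` | facts |
| Def. 4.28 (p. 61; l. 2540) FJ cycle ∕ natural FJ cycle `FJ(f₁,f₂;φ)_K^♮` | `CycleData.FJ`, `CycleData.FJnat` | DEFINED |
| Lem. 4.29 (p. 61; l. 2548) | `CycleData.Lem429_1AsPrinted`, `CycleData.Lem429_2AsPrinted` | facts |
| p. 62 (ll. 2586–2593) `CH^i(X_∞ × X_∞ × A_μ)^?_L`, well-defined `FJ(f₁,f₂;φ)` | fields `CHinf0`, `rhoInf0`, `toInf0`, `FJinf`; `CycleData.FJinfWellDefined` (fact) | ⟨CARRIER⟩ + fact |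
| Lem. 4.30 (p. 62; l. 2597) | `CycleData.Lem430AsPrinted` | fact |
(§4.4, items 4.31–4.38 incl. Def. 4.35, is TL-t02's `Sec44ArithmeticGGP`, which carries its own data; nothing of §4.4 is typed here.)

## AS PRINTED (the numbered items, verbatim; the running text is quoted in the docstrings where it is typed)

«**Definition 4.24.** Let `Π` be a relevant representation of `GL_n(𝔸_E)` (Definition 1.2). We define `Φ_Π` to be the set
of isomorphism classes of pairs `(𝕍, π^∞)`, where • `𝕍` is a totally positive definition incoherent hermitian space over
`𝔸_E` of rank `n`, • `π^∞` is an irreducible admissible representation of `𝔾(𝔸_F^∞)` such that – for a nonarchimedean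
place `v` of `F` either split in `E` or at which `π^∞_v` is unramified, we have `BC(π^∞_v) ≃ Π_v`, – `π^∞` appears in
`H^i_{B,τ'}(S̃h(𝕍), ℂ)` as a subquotient representation of `𝔾(𝔸_F^∞)` for some `i ∈ ℤ` and some place `τ' : E → ℂ`.» (pp. 57–58)
«**Proposition 4.25.** Let `Π` be a relevant representation of `GL_n(𝔸_E)`. For `(𝕍, π^∞) ∈ Φ_Π`, we have for every
`τ' : E → ℂ` that (1) `π^∞` appears in `H^i_{B,τ'}(S̃h(𝕍), ℂ)` semisimply for every `i`, (2) `π^∞` does not appear in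
`H^i_{B,τ'}(S̃h(𝕍), ℂ)` if `i ≠ n − 1`, (3) `H^i_{B,τ'}(S̃h(𝕍), ℂ)[π^∞] = IH^i_{B,τ'}(S̃h(𝕍), ℂ)[π^∞]` for every `i`.» (p. 58)
«**Definition 4.26.** Let `Π` and `(𝕍, π^∞)` be as in Proposition 4.25. Let `K ⊆ 𝔾(𝔸_F^∞)` be a level subgroup. We say
that a function `f ∈ 𝓗_{K,𝕃}`, where `𝕃` is some subfield of `ℂ`, is a *test function for `π^∞`*, if the element
`cl_{B,τ'}(𝕋_K^f) ∈ H^{2n−2}_{B,τ'}(S̃h(𝕍)_K × S̃h(𝕍)_K, ℂ)` belongs to the subspace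
`H^{n−1}_{B,τ'}(S̃h(𝕍)_K, ℂ)[(π^∞)^K] ⊗_ℂ H^{n−1}_{B,τ'}(S̃h(𝕍)_K, ℂ)[((π^∞)^∨)^K]` under the Künneth decomposition for every
`τ' : E → ℂ`.» (p. 58)
«[Step 3] Put `FJ(f₁,f₂;φ)_K := |π₀((X_K)_{E^{ac}})| · (𝕋_K^{f₁} ⊗ 𝕋_K^{f₂} ⊗ 𝕋^{can}_μ)^* (id_{X_K×X_K} × (φ ∘ α_K))_*
(Δ³X_K × D_K^{n−1})^∇` as an element in `CH^{n−1+[M_μ:ℚ]/2}(X_K × X_K × A_μ)_𝕃`.» (p. 60)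
«**Proposition 4.27.** Let the notation be as above. (1) The cycle `FJ(f₁,f₂;φ)_K` belongs to
`CH^{n−1+[M_μ:ℚ]/2}(X_K × X_K × A_μ)^0_𝕃`. (2) The image of `FJ(f₁,f₂;φ)_K` in `CH^{n−1+[M_μ:ℚ]/2}(X_K × X_K × A_μ)^♮_𝕃`
belongs to the subspace `CH^{n−1+[M_μ:ℚ]/2}(X_K × X_K × A_μ)^♮_𝕃[i_μ]` and depends only on the homological equivalence class
of `𝕋_K^{f₁} ⊗ 𝕋_K^{f₂}`.» (p. 60)
«**Definition 4.28** (Fourier–Jacobi cycles). We call `FJ(f₁,f₂;φ)_K` a *Fourier–Jacobi cycle* for `Π₁ × Π₂ ⊗ μ`. We call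
the image of `FJ(f₁,f₂;φ)_K` in `CH^{n−1+[M_μ:ℚ]/2}(X_K × X_K × A_μ)^♮_𝕃[i_μ]`, denoted by `FJ(f₁,f₂;φ)_K^♮`, a *natural
Fourier–Jacobi cycle* for `Π₁ × Π₂ ⊗ μ`.» (p. 61)
«**Lemma 4.29.** We have (1) Let `K' ⊆ K` be a smaller level subgroup. Then we have
`(u^{K'}_K × u^{K'}_K × id_{A_μ})^* FJ(f₁,f₂;φ)_K = FJ(f₁,f₂;φ)_{K'}`. (2) For `g ∈ 𝔾(𝔸_F^∞)`, we have
`(𝕋_g × 𝕋_g × id_{A_μ})^* FJ(f₁,f₂;φ)_K = FJ(R_g L_g f₁, R_g L_g f₂; gφ)_{gKg⁻¹}`, where `𝕋_g : X_{gKg⁻¹} → X_K` is the Hecke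
translation.» (p. 61)
«**Lemma 4.30.** For every elements `g, g₁, g₂ ∈ 𝔾(𝔸_F^∞)`, we have
`FJ(R_{g₁} f₁, R_{g₂} f₂; φ) = (𝕋_{g₁} × 𝕋_{g₂} × id_{A_μ})^* FJ(f₁,f₂;φ)`, `FJ(L_g f₁, L_g f₂; gφ) = FJ(f₁,f₂;φ)`, where
`𝕋_g : X_∞ → X_∞` denotes the Hecke translation by `g`.» (p. 62)

## The typing.  REAL = tree object; DEFINED = defined here; ⟨CARRIER⟩ = posited datum for a printed object the tree cannot
## construct (discipline of `Thm418AsPrinted` ∕ `Def45AsPrinted` ∕ `Sec41MotivesCMCharacters`).  Nothing is asserted; every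
## fact is a predicate ON the data (a consumer takes `(h : C.Prop427_1AsPrinted …)` for ITS OWN data; `∀ data, …` is not
## claimed).  Every fact of §4.3 after Def. 4.26 carries the printed standing notation as the hypothesis `S.NotationAsAbove Rel₁ Rel₂
## π₁ π₁d π₂ π₂d` («We fix two relevant representations `Π₁` and `Π₂` … pairs `(𝕍, π_i^∞) ∈ Φ_{Π_i}`», p. 58; contragredients of
## Def. 4.26) and the test-function hypotheses on `f₁, f₂` (Step 3), so that nothing is stated for more `π`'s or `f`'s than print.

* The ambient datum is the tree's `Liu2021.Thm418Data F E` (`D`): `F` totally real, `E ∕ F` totally imaginary quadratic,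
  `n = D.n ≥ 2`, the token `D.𝕍`, `𝔾(𝔸_F^∞) = D.G` (topological group), `μ = D.μ` conjugate symplectic of weight one («fix a
  conjugate symplectic automorphic character `μ` … of weight one», p. 57 L4), `M_μ = Liu2021.fieldOfValues E D.μ`, the
  objects `D.Obj` of `𝒜(μ)`, `Ω(μ) = D.Ω` with its `M_μ[G]`-structure `D.rhoΩ` and `Hom_E(A_K, A_μ)_ℚ = D.HomK K D_μ` with
  `D.res` (Def. 4.16 ∕ Rem. 4.17 ∕ Thm. 4.18 (1)), `μ`-admissible collections `D.IsAdmissible ε` (Def. 4.12) — all REAL (tree).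
* `𝕃 ⊆ ℂ` = `L : Subfield ℂ` with `hL : M_μ ⊆ 𝕃` (p. 59 L1); the canonical projector `𝕋^{can}_μ` = `P.Tcan x` of
  `Sec41MotivesCMCharacters.ProjectorData` (`P : ProjectorData D.isConjugateSymplectic D.hasWeight_one`, over the same `μ`; the
  instance hypothesis `[IsCMField E]` of this file is the tree theorem `Liu2021.isCMField F E`, carried as a binder so that the
  §4.1 vocabulary applies verbatim) for an `I_1`-generator `x` (Def. 4.9; READING R4 of that file: independent of `x` by
  `P.Def49AsPrinted`).  READING R3: `P.A`, `P.i` are the first two components of the chosen `D_μ : D.Obj`.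
* Hecke algebra: REAL as FUNCTIONS `f : D.G → 𝕃` — `𝓗_{K,𝕃} = C_c^∞(K\G/K, 𝕃)` is the predicate `MemHecke K f` (bi-`K`-invariant,
  supported on finitely many double cosets), `𝓗_𝕃 = ⋃_K 𝓗_{K,𝕃}` is `MemFullHecke`; `L_g f (x) = f(g⁻¹x)`, `R_g f (x) = f(xg)`,
  `𝟙_K` REAL; the convolution «with respect to the canonical volume» is the ⟨CARRIER⟩ `conv` (no Haar measure
  on the token group).  READING R1: print does not spell out `L_g`, `R_g`; the convention is fixed so that `R_g L_g f (x) =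
  f(g⁻¹ x g)`, which is bi-`gKg⁻¹`-invariant for `f ∈ 𝓗_K` as Lem. 4.29 (2) requires.
* Shimura side (`ShimuraData`): per level `K`, ⟨CARRIER⟩ `CHXX K : AlgCat 𝕃` = `CH^{n−1}(X_K × X_K)_𝕃` (ring of
  correspondences), `T K f` = `𝕋_K^f`, `HB K τ' i` = `H^i_{B,τ'}(X_K, ℂ)`, `HBXX K τ'` = `H^{2n−2}_{B,τ'}(X_K × X_K, ℂ)` with the
  Künneth map `kunneth` and the cycle class `clXX`; `isoPart K τ' π` = `H^{n−1}_{B,τ'}(X_K, ℂ)[(π^∞)^K]`; `HBinf τ' i` =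
  `H^i_{B,τ'}(S̃h(𝕍), ℂ) = colim_K H^i(X_K)` with its `G`-action `rhoB` and `IH τ' i ⊆ HBinf τ' i` (intersection cohomology, §D.2,
  READING R4: placed inside `H^i` as in the proof of Prop. 4.25); `RelRep` = relevant representations of `GL_n(𝔸_E)` (Def. 1.2,
  token) with `LocalBC Π π` = the first sub-bullet of Def. 4.24 (local base change, token).  Representations `π^∞` are complex (`Representation ℂ D.G V`), irreducibility = Mathlib `Representation.IsIrreducible`,
  admissibility REAL (`IsAdmissibleRep`), «appears as a subquotient» REAL (`AppearsIn`), READING R5 for «semisimply».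
* `A_μ` side (`CycleData`, for the chosen `D_μ : D.Obj` and `P`): ⟨CARRIER⟩ `CH3 K` = `CH^{n−1+[M_μ:ℚ]/2}(X_K × X_K × A_μ)_𝕃`
  with `CH3zero K` (`…^0_𝕃`, homologically trivial), `CH3nat K` (`…^♮_𝕃 = (CH^0_ℚ ∕ CH^1_ℚ) ⊗ 𝕃`, §3 Def. of natural cycles)
  and `toNat` (`CH^0 → CH^♮`), `actM K x` (the action of `i_μ(x)` through the factor `A_μ`), `IsIntegralHom` (`φ ∈ Hom_E(A_K,A_μ)`
  inside `Hom_E(A_K,A_μ)_ℚ`), `step2 K φ` = Steps 1–2 (`(id × id × (φ∘α_K))_*(Δ³X_K × D_K^{n−1})^∇`), `corrPull K c₁ c₂ t` =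
  `(c₁ ⊗ c₂ ⊗ t)^*`, `pullLevel`, `pullHecke`, `gHom` (`φ ↦ gφ`), `resHom`; infinite level `CHinf0` = `CH(X_∞ × X_∞ × A_μ)^0_𝕃`
  with `(g₁,g₂) ↦ (𝕋_{g₁} × 𝕋_{g₂} × id)^*` (`rhoInf0`), `toInf0`, and `FJinf f₁ f₂ φ` = the well-defined element `FJ(f₁,f₂;φ)`
  (p. 62), tied to the finite-level cycles by the fact `FJinfWellDefined`.
  DEFINED: `FJ` (Step 3 formula), `natIota` (`CH^♮[i_μ]`, an intersection of eigenspaces), `FJnat`, `HomEquivTT` (homological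
  equivalence of `𝕋^{f₁}_K ⊗ 𝕋^{f₂}_K`, READING R2: read through Künneth as equality of `cl(𝕋^{f₁}) ⊗ cl(𝕋^{f₂})` for every `τ'`).

## References
* [Liu2021] Y. Liu, Camb. J. Math. 9 (2021) 1–147 = arXiv:2102.11518 — §4.3, pp. 57–63.
* Cited through [Liu2021] only (not read for this file): [Art13] Arthur 2013, [Car12] Caraiani 2012, [Mok15], [KMSW] (proof of
  Prop. 4.25).
-/

noncomputable section

open NumberField

namespace Literature.NumberTheory.Automorphic.Liu2021.Sec43FourierJacobiCycles

/-! ## §4.3 preamble (p. 57): Hecke functions — REAL -/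

section Hecke

variable {G : Type} [Group G] {R : Type}

/-- `f` is bi-`K`-invariant: `f(k₁ g k₂) = f(g)` («`𝓗_{K,R} := C_c^∞(K\𝔾(𝔸_F^∞)/K, R)`», p. 57 L14).  REAL.
[cite: Liu2021, §4.3 p. 57 L14] -/
def IsBiInvariant (K : Subgroup G) (f : G → R) : Prop :=
  ∀ k₁ ∈ K, ∀ k₂ ∈ K, ∀ g : G, f (k₁ * g * k₂) = f g

/-- `f` is supported on finitely many double cosets `K s K` (compact support modulo `K`, the `c` of `C_c^∞`, p. 57 L9∕L14).
REAL. [cite: Liu2021, §4.3 p. 57 L9–14] -/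
def HasFiniteDoubleCosetSupport [Zero R] (K : Subgroup G) (f : G → R) : Prop :=
  ∃ S : Finset G, ∀ g : G, f g ≠ 0 → ∃ s ∈ S, ∃ k₁ ∈ K, ∃ k₂ ∈ K, g = k₁ * s * k₂

/-- **`f ∈ 𝓗_{K,R} = C_c^∞(K\𝔾(𝔸_F^∞)/K, R)`** (p. 57 L14) for a level subgroup `K`: bi-`K`-invariant and compactly supported.
REAL. [cite: Liu2021, §4.3 p. 57 L14] -/
def MemHecke [Zero R] (K : Subgroup G) (f : G → R) : Prop :=
  IsBiInvariant K f ∧ HasFiniteDoubleCosetSupport K f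

/-- **`L_g`**, the left translation on `𝓗_R` (p. 57 L12), READING R1: `(L_g f)(x) = f(g⁻¹ x)`.  REAL.
[cite: Liu2021, §4.3 p. 57 L12] -/
def leftTranslate (g : G) (f : G → R) : G → R :=
  fun x => f (g⁻¹ * x)

/-- **`R_g`**, the right translation on `𝓗_R` (p. 57 L12), READING R1: `(R_g f)(x) = f(x g)`.  REAL.
[cite: Liu2021, §4.3 p. 57 L12] -/
def rightTranslate (g : G) (f : G → R) : G → R :=
  fun x => f (x * g)

/-- **`𝟙_K`** (p. 57 L17: «if `f = 𝟙_K`, then `𝕋_K^f = vol(K) · ΔX_K`»).  REAL (`Set.indicator`).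
[cite: Liu2021, §4.3 p. 57 L17] -/
def indicatorFun [Zero R] [One R] (K : Subgroup G) : G → R :=
  Set.indicator (K : Set G) 1

end Hecke

variable {F E : Type} [Field F] [NumberField F] [IsTotallyReal F] [Field E] [NumberField E] [Algebra F E]
  [IsTotallyComplex E] [Algebra.IsQuadraticExtension F E] [IsCMField E]

/-! ## The Shimura-side data of §4.3 (p. 57 preamble; Def. 4.24–4.26), ⟨CARRIER⟩s in print order -/

/-- **Shimura-side data of [Liu2021, §4.3]** over the tree's datum `D : Thm418Data F E` (`𝕍`, `G = 𝔾(𝔸_F^∞)`, `n`, `μ`) and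
the coefficient field `𝕃 = L ⊆ ℂ`: level subgroups, volumes, the correspondence rings `CH^{n−1}(X_K × X_K)_𝕃` with the Hecke
correspondences `𝕋_K^f`, Betti cohomology of `X_K = S̃h(𝕍)_K` and of `S̃h(𝕍)` with the `G`-action, and the tokens for Def. 1.2 ∕
local base change.  A hypothesis carrier: nothing is asserted (module docstring, «The typing»).
[cite: Liu2021, §4.3 pp. 57–58 (TeX ll. 2397–2470)] -/
structure ShimuraData (D : Liu2021.Thm418Data F E) (L : Subfield ℂ) : Type 2 where
  /-- «Let `𝕃 ⊆ ℂ` be a subfield containing `M_μ`» (p. 59 L1; Conj. 4.31). -/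
  hL : (Liu2021.fieldOfValues E D.μ).toSubfield ≤ L
  /-- ⟨CARRIER⟩ «sufficiently small open compact subgroups `K ⊆ 𝔾(𝔸_F^∞)` that are decomposable … we call such `K` a *level
  subgroup*» (p. 57 L5–8). -/
  IsLevel : Subgroup D.G → Prop
  /-- ⟨CARRIER⟩ «the canonical volume» `vol(K) = 1 ⁄ (deg D_K^{n−1} · |π₀((X_K)_{E^{ac}})|)` (Def. 4.22 (2), p. 55), a positive
  rational number (Lem. 4.23 (4)). -/
  vol : Subgroup D.G → ℚ
  /-- ⟨CARRIER⟩ `|π₀((X_K)_{E^{ac}})|`, the number of geometric connected components of `X_K` (Step 3, p. 60 L1). -/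
  numComp : Subgroup D.G → ℕ
  /-- ⟨CARRIER⟩ the convolution product of `𝓗_{K,𝕃}` «with respect to the canonical volume» (p. 57 L10–11; `f₁ᵗ ∗ f₁^∨`, p. 66 L14). -/
  conv : Subgroup D.G → (D.G → L) → (D.G → L) → (D.G → L)
  /-- ⟨CARRIER⟩ `CH^{n−1}(X_K × X_K)_𝕃`, the `𝕃`-algebra of correspondences of `X_K = S̃h(𝕍)_K` (composition; p. 57 L18–20). -/
  CHXX : Subgroup D.G → AlgCat.{0} L
  /-- ⟨CARRIER⟩ `f ↦ 𝕋_K^f`, «the Hecke correspondence `𝕋_K^f`, normalized by `vol(K)`», as a class in `CH^{n−1}(X_K × X_K)_𝕃`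
  (p. 57 L15–20; meaningful for `f ∈ 𝓗_{K,𝕃}`). -/
  T : ∀ K : Subgroup D.G, (D.G → L) → CHXX K
  /-- ⟨CARRIER⟩ the class `[ΔX_K] ∈ CH^{n−1}(X_K × X_K)_𝕃` of the diagonal (p. 57 L17). -/
  diag : ∀ K : Subgroup D.G, CHXX K
  /-- ⟨CARRIER⟩ `H^i_{B,τ'}(X_K, ℂ)`, Betti cohomology of `X_K ⊗_{E,τ'} ℂ` (Def. 4.26; §4.2 p. 46). -/
  HB : Subgroup D.G → (E →+* ℂ) → ℕ → ModuleCat.{0} ℂ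
  /-- ⟨CARRIER⟩ `H^{2n−2}_{B,τ'}(X_K × X_K, ℂ)` (Def. 4.26). -/
  HBXX : Subgroup D.G → (E →+* ℂ) → ModuleCat.{0} ℂ
  /-- ⟨CARRIER⟩ the Künneth map `H^{n−1}_{B,τ'}(X_K, ℂ) ⊗_ℂ H^{n−1}_{B,τ'}(X_K, ℂ) → H^{2n−2}_{B,τ'}(X_K × X_K, ℂ)` («under the
  Künneth decomposition», Def. 4.26). -/
  kunneth : ∀ (K : Subgroup D.G) (τ' : E →+* ℂ),
    TensorProduct ℂ (HB K τ' (D.n - 1)) (HB K τ' (D.n - 1)) →ₗ[ℂ] HBXX K τ'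
  /-- ⟨CARRIER⟩ the cycle class map `cl_{B,τ'} : CH^{n−1}(X_K × X_K)_𝕃 → H^{2n−2}_{B,τ'}(X_K × X_K, ℂ)` (Def. 4.26). -/
  clXX : ∀ (K : Subgroup D.G) (τ' : E →+* ℂ), CHXX K → HBXX K τ'
  /-- ⟨CARRIER⟩ `H^{n−1}_{B,τ'}(X_K, ℂ)[(π^∞)^K]`, the `(π^∞)^K`-isotypic part for the Hecke algebra `𝓗_{K,ℂ}`, for a smooth
  representation `π^∞` of `G` (Def. 4.26). -/
  isoPart : ∀ (K : Subgroup D.G) (τ' : E →+* ℂ) {V : Type} [AddCommGroup V] [Module ℂ V],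
    Representation ℂ D.G V → Submodule ℂ (HB K τ' (D.n - 1))
  /-- ⟨CARRIER⟩ `H^i_{B,τ'}(S̃h(𝕍), ℂ) := colim_K H^i_{B,τ'}(X_K, ℂ)` (Def. 4.24, Prop. 4.25; cf. §4.2 p. 46). -/
  HBinf : (E →+* ℂ) → ℕ → ModuleCat.{0} ℂ
  /-- ⟨CARRIER⟩ the (smooth) action of `𝔾(𝔸_F^∞)` on `H^i_{B,τ'}(S̃h(𝕍), ℂ)` by Hecke correspondences. -/
  rhoB : ∀ (τ' : E →+* ℂ) (i : ℕ), Representation ℂ D.G (HBinf τ' i)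
  /-- ⟨CARRIER⟩ `IH^i_{B,τ'}(S̃h(𝕍), ℂ) ⊆ H^i_{B,τ'}(S̃h(𝕍), ℂ)`, the intersection cohomology (of the Baily–Borel
  compactifications, §D.2), READING R4: placed inside `H^i` as in the proof of Prop. 4.25 («the quotient representation
  `H^i_B(…)/IH^i_B(…)`», p. 58). -/
  IH : ∀ (τ' : E →+* ℂ) (i : ℕ), Submodule ℂ (HBinf τ' i)
  /-- ⟨CARRIER⟩ the relevant representations `Π` of `GL_n(𝔸_E)` (Def. 1.2, p. 5; token). -/
  RelRep : Type
  /-- ⟨CARRIER⟩ Def. 4.24, first sub-bullet, for `Π` and a representation `π^∞` of `G`: «for a nonarchimedean place `v` of `F`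
  either split in `E` or at which `π^∞_v` is unramified, we have `BC(π^∞_v) ≃ Π_v`» (local base change; token). -/
  LocalBC : RelRep → ∀ {V : Type} [AddCommGroup V] [Module ℂ V], Representation ℂ D.G V → Prop

namespace ShimuraData

variable {D : Liu2021.Thm418Data F E} {L : Subfield ℂ} (S : ShimuraData D L)

/-- The inclusion `M_μ ⊆ 𝕃` (p. 59 L1) on elements.  DEFINED (`Subfield.inclusion`). [cite: Liu2021, §4.3 p. 59 L1] -/
def inclL (x : Liu2021.fieldOfValues E D.μ) : L :=
  Subfield.inclusion S.hL ⟨(x : ℂ), x.2⟩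

/-- **`f ∈ 𝓗_𝕃 = C_c^∞(𝔾(𝔸_F^∞), 𝕃) = colim_K 𝓗_{K,𝕃}`** (p. 57 L9, L21 «`𝓗_R = lim_K 𝓗_{K,R}`»): `f ∈ 𝓗_{K,𝕃}` for some level
subgroup `K`.  DEFINED. [cite: Liu2021, §4.3 p. 57 L9–21] -/
def MemFullHecke (f : D.G → L) : Prop :=
  ∃ K : Subgroup D.G, S.IsLevel K ∧ MemHecke K f

/-- **[Liu2021, p. 57 L15–20] «[`𝕋_K`] sending `f` to the Hecke correspondence `𝕋_K^f`, normalized by `vol(K)`. For example, if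
`f = 𝟙_K`, then `𝕋_K^f = vol(K) · ΔX_K` … The induced map `𝕋_K : 𝓗_{K,R} → CH^{n−1}(X_K × X_K)_R` is a homomorphism of
`R`-algebras»** (here `R = 𝕃`): additive, `𝕃`-linear, multiplicative for the convolution `conv K`, and `𝕋_K^{𝟙_K} = vol(K)·[ΔX_K]`,
on `𝓗_{K,𝕃}`.  Named fact (unnumbered printed claim); NO PROOF. [cite: Liu2021, §4.3 p. 57 L15–20] -/
def HeckeMapAlgHom : Prop :=
  ∀ K : Subgroup D.G, S.IsLevel K →
    (∀ f₁ f₂ : D.G → L, MemHecke K f₁ → MemHecke K f₂ →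
        S.T K (f₁ + f₂) = S.T K f₁ + S.T K f₂ ∧ S.T K (S.conv K f₁ f₂) = S.T K f₁ * S.T K f₂) ∧
      (∀ (a : L) (f : D.G → L), MemHecke K f → S.T K (a • f) = a • S.T K f) ∧
        S.T K (indicatorFun K) = (S.vol K : L) • S.diag K

/-! ## Definition 4.24 (pp. 57–58; TeX l. 2421) -/

/-- **«`π^∞` appears in `H` as a subquotient representation of `𝔾(𝔸_F^∞)`»** (Def. 4.24, second sub-bullet), for a representation
`(ρ, W)` of `G` and `(π, V)`: there are a `G`-stable subspace `N' ⊆ W` and a surjective `G`-equivariant linear map `N' → V`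
(whose kernel is then the `G`-stable `N` with `N'/N ≃ π`).  DEFINED (REAL). [cite: Liu2021, Def. 4.24 (p. 58)] -/
def AppearsIn {V W : Type} [AddCommGroup V] [Module ℂ V] [AddCommGroup W] [Module ℂ W]
    (π : Representation ℂ D.G V) (ρ : Representation ℂ D.G W) : Prop :=
  ∃ (N' : Submodule ℂ W) (hN' : ∀ (g : D.G) (w : W), w ∈ N' → ρ g w ∈ N'),
    ∃ f : N' →ₗ[ℂ] V, Function.Surjective f ∧
      ∀ (g : D.G) (w : N'), f ⟨ρ g w, hN' g w w.2⟩ = π g (f w)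

/-- **«irreducible admissible representation of `𝔾(𝔸_F^∞)`»** (Def. 4.24; §4.2 p. 46), the admissibility half: `π` is smooth
(every vector is fixed by an open compact subgroup) and has finite-dimensional invariants under every open compact subgroup
(`Liu2021.IsOpenCompact`).  Irreducibility is Mathlib's `Representation.IsIrreducible`.  DEFINED (REAL).
[cite: Liu2021, Def. 4.24 (p. 57)] -/
def IsAdmissibleRep {V : Type} [AddCommGroup V] [Module ℂ V] (π : Representation ℂ D.G V) : Prop :=
  (∀ v : V, ∃ K : Subgroup D.G, Liu2021.IsOpenCompact K ∧ ∀ k ∈ K, π k v = v) ∧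
    ∀ K : Subgroup D.G, Liu2021.IsOpenCompact K → FiniteDimensional ℂ (Representation.invariants (π.comp K.subtype))

/-- **[Liu2021, Def. 4.24] `(𝕍, π^∞) ∈ Φ_Π`** for the fixed `𝕍` of the datum: «`π^∞` is an irreducible admissible representation of
`𝔾(𝔸_F^∞)` such that – [local base change: `BC(π^∞_v) ≃ Π_v` for `v` split or unramified — the token `LocalBC`], – `π^∞` appears in
`H^i_{B,τ'}(S̃h(𝕍), ℂ)` as a subquotient representation of `𝔾(𝔸_F^∞)` for some `i ∈ ℤ` and some place `τ' : E → ℂ`» (pp. 57–58;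
`Φ_Π` collects the isomorphism classes of such pairs over all `𝕍` of rank `n`).  DEFINED. [cite: Liu2021, Def. 4.24 (pp. 57–58)] -/
def MemPhi (Rel : S.RelRep) {V : Type} [AddCommGroup V] [Module ℂ V] (π : Representation ℂ D.G V) : Prop :=
  π.IsIrreducible ∧ IsAdmissibleRep π ∧ S.LocalBC Rel π ∧
    ∃ (i : ℕ) (τ' : E →+* ℂ), AppearsIn π (S.rhoB τ' i)

/-! ## Proposition 4.25 (p. 58; TeX l. 2436) -/

/-- **«`π^∞` appears in `H` semisimply»** (Prop. 4.25 (1)), READING R5: every occurrence of `π` as a `G`-equivariant quotient of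
a `G`-stable subspace `N' ⊆ W` splits `G`-equivariantly (so the `π^∞`-part of `W` is a direct sum of copies of `π^∞`).  DEFINED.
[cite: Liu2021, Prop. 4.25 (1) (p. 58)] -/
def AppearsSemisimply {V W : Type} [AddCommGroup V] [Module ℂ V] [AddCommGroup W] [Module ℂ W]
    (π : Representation ℂ D.G V) (ρ : Representation ℂ D.G W) : Prop :=
  ∀ (N' : Submodule ℂ W) (hN' : ∀ (g : D.G) (w : W), w ∈ N' → ρ g w ∈ N') (f : N' →ₗ[ℂ] V),
    Function.Surjective f → (∀ (g : D.G) (w : N'), f ⟨ρ g w, hN' g w w.2⟩ = π g (f w)) →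
      ∃ s : V →ₗ[ℂ] N', (∀ v : V, f (s v) = v) ∧ ∀ (g : D.G) (v : V), (s (π g v) : W) = ρ g (s v)

/-- **«`π^∞` appears in `W ∕ U` as a subquotient»** for a `G`-stable subspace `U ⊆ W` (used for Prop. 4.25 (3) with
`U = IH^i`): a `G`-stable `N' ⊆ W` and a surjective `G`-map `N' → V` killing `N' ∩ U`.  DEFINED. [cite: Liu2021, Prop. 4.25 (3) (p. 58)] -/
def AppearsInMod {V W : Type} [AddCommGroup V] [Module ℂ V] [AddCommGroup W] [Module ℂ W]
    (U : Submodule ℂ W) (π : Representation ℂ D.G V) (ρ : Representation ℂ D.G W) : Prop :=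
  ∃ (N' : Submodule ℂ W) (hN' : ∀ (g : D.G) (w : W), w ∈ N' → ρ g w ∈ N'),
    ∃ f : N' →ₗ[ℂ] V, Function.Surjective f ∧
      (∀ (g : D.G) (w : N'), f ⟨ρ g w, hN' g w w.2⟩ = π g (f w)) ∧ ∀ w : N', (w : W) ∈ U → f w = 0

/-- **[Liu2021, Prop. 4.25] «Let `Π` be a relevant representation of `GL_n(𝔸_E)`. For `(𝕍, π^∞) ∈ Φ_Π`, we have for every
`τ' : E → ℂ` that (1) `π^∞` appears in `H^i_{B,τ'}(S̃h(𝕍), ℂ)` semisimply for every `i`, (2) `π^∞` does not appear in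
`H^i_{B,τ'}(S̃h(𝕍), ℂ)` if `i ≠ n − 1`, (3) `H^i_{B,τ'}(S̃h(𝕍), ℂ)[π^∞] = IH^i_{B,τ'}(S̃h(𝕍), ℂ)[π^∞] for every `i`»** (p. 58), (3) in
READING R4∕R5: `π^∞` does not appear in `H^i ∕ IH^i`.  Named fact (predicate on `S`, for the given `Π`, `π`); NO PROOF (printed
proof: [Car12, Thm. 1.2], [Art13], [Mok15], [KMSW], §D.2). [cite: Liu2021, Prop. 4.25 (p. 58)] -/
def Prop425AsPrinted (Rel : S.RelRep) {V : Type} [AddCommGroup V] [Module ℂ V] (π : Representation ℂ D.G V) : Prop :=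
  S.MemPhi Rel π → ∀ (τ' : E →+* ℂ) (i : ℕ),
    AppearsSemisimply π (S.rhoB τ' i) ∧
      (i ≠ D.n - 1 → ¬ AppearsIn π (S.rhoB τ' i)) ∧
        ¬ AppearsInMod (S.IH τ' i) π (S.rhoB τ' i)

/-! ## Definition 4.26 (p. 58; TeX l. 2459) -/

/-- **`(π^∞)^∨`, the contragredient**, as a relation between two smooth representations of `G` (Def. 4.26 uses
`H^{n−1}[((π^∞)^∨)^K]`; Conj. 4.31 uses `(π_i^∞)^∨`): a non-degenerate `G`-invariant bilinear pairing `V × V^∨ → k`.  DEFINED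
(REAL), for any coefficient field `k`. [cite: Liu2021, Def. 4.26 (p. 58)] -/
def IsDualPair {k : Type} [Field k] {V W : Type} [AddCommGroup V] [Module k V] [AddCommGroup W] [Module k W]
    (π : Representation k D.G V) (πd : Representation k D.G W) : Prop :=
  ∃ B : V →ₗ[k] W →ₗ[k] k,
    (∀ (g : D.G) (v : V) (w : W), B (π g v) (πd g w) = B v w) ∧
      (∀ v : V, (∀ w : W, B v w = 0) → v = 0) ∧ ∀ w : W, (∀ v : V, B v w = 0) → w = 0

/-- **[Liu2021, Def. 4.26] «We say that a function `f ∈ 𝓗_{K,𝕃}` … is a *test function for `π^∞`*, if the element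
`cl_{B,τ'}(𝕋_K^f) ∈ H^{2n−2}_{B,τ'}(S̃h(𝕍)_K × S̃h(𝕍)_K, ℂ)` belongs to the subspace
`H^{n−1}_{B,τ'}(S̃h(𝕍)_K, ℂ)[(π^∞)^K] ⊗_ℂ H^{n−1}_{B,τ'}(S̃h(𝕍)_K, ℂ)[((π^∞)^∨)^K]` under the Künneth decomposition for every
`τ' : E → ℂ`»** (p. 58), for `K` a level subgroup, `π = π^∞` and `πd = (π^∞)^∨` (any contragredient, `IsDualPair`).  DEFINED.
[cite: Liu2021, Def. 4.26 (p. 58)] -/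
def IsTestFunction (K : Subgroup D.G) {V W : Type} [AddCommGroup V] [Module ℂ V] [AddCommGroup W] [Module ℂ W]
    (π : Representation ℂ D.G V) (πd : Representation ℂ D.G W) (f : D.G → L) : Prop :=
  MemHecke K f ∧ ∀ τ' : E →+* ℂ,
    S.clXX K τ' (S.T K f) ∈
      (LinearMap.range (TensorProduct.map (S.isoPart K τ' π).subtype (S.isoPart K τ' πd).subtype)).map (S.kunneth K τ')

/-- **«Let the notation be as above»** (Prop. 4.27, p. 60), the standing notation of §4.3 from p. 58 last paragraph:
«We fix two relevant representations `Π₁` and `Π₂` of `GL_n(𝔸_E)`, and consider pairs `(𝕍, π_i^∞) ∈ Φ_{Π_i}` for `i = 1, 2` with the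
same `𝕍`» (Def. 4.24), together with the contragredients `(π_i^∞)^∨` of Def. 4.26 (`IsDualPair`).  Bundled as one predicate
so that every later fact carries exactly the printed hypotheses.  DEFINED. [cite: Liu2021, §4.3 p. 58 (last paragraph) and Prop. 4.27 (p. 60)] -/
def NotationAsAbove (Rel₁ Rel₂ : S.RelRep) {V₁ W₁ V₂ W₂ : Type} [AddCommGroup V₁] [Module ℂ V₁] [AddCommGroup W₁]
    [Module ℂ W₁] [AddCommGroup V₂] [Module ℂ V₂] [AddCommGroup W₂] [Module ℂ W₂]
    (π₁ : Representation ℂ D.G V₁) (π₁d : Representation ℂ D.G W₁)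
    (π₂ : Representation ℂ D.G V₂) (π₂d : Representation ℂ D.G W₂) : Prop :=
  S.MemPhi Rel₁ π₁ ∧ S.MemPhi Rel₂ π₂ ∧ IsDualPair π₁ π₁d ∧ IsDualPair π₂ π₂d

/-- **«the homological equivalence class of `𝕋_K^{f₁} ⊗ 𝕋_K^{f₂}`»** (Prop. 4.27 (2)), READING R2: `𝕋^{f₁}_K ⊗ 𝕋^{f₂}_K` and
`𝕋^{f₁'}_K ⊗ 𝕋^{f₂'}_K` are homologically equivalent iff `cl_{B,τ'}(𝕋^{f₁}_K) ⊗ cl_{B,τ'}(𝕋^{f₂}_K) = cl_{B,τ'}(𝕋^{f₁'}_K) ⊗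
cl_{B,τ'}(𝕋^{f₂'}_K)` in `H^{2n−2}_{B,τ'}(X_K×X_K) ⊗ H^{2n−2}_{B,τ'}(X_K×X_K)` for every `τ'` (Künneth for `(X_K × X_K)²`; one `τ'`
suffices by comparison).  DEFINED. [cite: Liu2021, Prop. 4.27 (2) (p. 60)] -/
def HomEquivTT (K : Subgroup D.G) (f₁ f₂ f₁' f₂' : D.G → L) : Prop :=
  ∀ τ' : E →+* ℂ,
    (S.clXX K τ' (S.T K f₁) ⊗ₜ[ℂ] S.clXX K τ' (S.T K f₂) :
        TensorProduct ℂ (S.HBXX K τ') (S.HBXX K τ')) =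
      S.clXX K τ' (S.T K f₁') ⊗ₜ[ℂ] S.clXX K τ' (S.T K f₂')


end ShimuraData

/-! ## The `A_μ`-side data of §4.3 (Steps 1–3, pp. 59–62), ⟨CARRIER⟩s in print order -/

/-- **`A_μ`-side data of [Liu2021, §4.3 pp. 59–62]** for the chosen CM datum `D_μ ∈ 𝒜(μ)` («Take a CM data
`D_μ = (A_μ, i_μ, λ_μ, r_μ) ∈ 𝒜(μ)`», p. 59 L4) — `Dμ : D.Obj` (tree) together with `P : ProjectorData` of §4.1 carrying
`(A_μ, i_μ)` and the canonical projector (READING R3: `P.A`, `P.i` are the first two components of `D_μ`): the Chow groups of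
`X_K × X_K × A_μ` with coefficients in `𝕃`, their `^0` ∕ `^♮` parts, the operations of Steps 1–3 and of Lem. 4.29, and the
infinite-level objects of p. 62.  A hypothesis carrier: nothing is asserted.
[cite: Liu2021, §4.3 pp. 59–62 (TeX ll. 2471–2593)] -/
structure CycleData {D : Liu2021.Thm418Data F E} {L : Subfield ℂ} (S : ShimuraData D L) (Dμ : D.Obj)
    (P : Sec41MotivesCMCharacters.ProjectorData D.isConjugateSymplectic D.hasWeight_one) : Type 2 where
  /-- ⟨CARRIER⟩ `CH^{n−1+[M_μ:ℚ]/2}(X_K × X_K × A_μ)_𝕃` (Step 2–3, p. 59–60). -/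
  CH3 : Subgroup D.G → ModuleCat.{0} L
  /-- ⟨CARRIER⟩ `CH^{n−1+[M_μ:ℚ]/2}(X_K × X_K × A_μ)^0_𝕃`, the homologically trivial classes (§3 Def. of `CH^i(X)^0_R`;
  Prop. 4.27 (1)). -/
  CH3zero : ∀ K : Subgroup D.G, Submodule L (CH3 K)
  /-- ⟨CARRIER⟩ `CH^{n−1+[M_μ:ℚ]/2}(X_K × X_K × A_μ)^♮_𝕃 = (CH^0_ℚ ∕ CH^1_ℚ) ⊗_ℚ 𝕃`, the natural cycles (§3; Prop. 4.27 (2)). -/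
  CH3nat : Subgroup D.G → ModuleCat.{0} L
  /-- ⟨CARRIER⟩ the quotient map `CH^0_𝕃 → CH^♮_𝕃` («the image of `FJ(f₁,f₂;φ)_K` in `CH^♮`», Prop. 4.27 (2)). -/
  toNat : ∀ K : Subgroup D.G, CH3zero K →ₗ[L] CH3nat K
  /-- ⟨CARRIER⟩ `x ↦` the action of `i_μ(x)`, `x ∈ M_μ`, on `CH^♮_𝕃` through the factor `A_μ` («the subspace … on which
  `i_μ(M_μ)` acts via the inclusion `M_μ ↪ 𝕃`», p. 60 L6–7). -/
  actM : ∀ K : Subgroup D.G, Liu2021.fieldOfValues E D.μ → Module.End L (CH3nat K)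
  /-- ⟨CARRIER⟩ «`φ ∈ Hom_E(A_K, A_μ)`» (Step 2, p. 59): the INTEGRAL homomorphisms inside `Hom_E(A_K, A_μ)_ℚ = D.HomK K D_μ`. -/
  IsIntegralHom : ∀ K : Subgroup D.G, D.HomK K Dμ → Prop
  /-- ⟨CARRIER⟩ Steps 1–2 (p. 59): `φ ↦ (id_{X_K×X_K} × (φ ∘ α_K))_* (Δ³X_K × D_K^{n−1})^∇ ∈ CH^{n−1+[M_μ:ℚ]/2}(X_K × X_K × A_μ)`
  — «Step 1: We start from the cycle `Δ³X_K × D_K^{n−1} ∈ CH^{3(n−1)}(X_K × X_K × X_K × X_K)_ℚ` … Put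
  `(Δ³X_K × D_K^{n−1})^∇ := Δ³X_K × D_K^{n−1} ∩ X_K × X_K × ∇X_K` … Step 2: Choose an element `φ ∈ Hom_E(A_K, A_μ)`. We push the
  above cycle along the morphism `id_{X_K×X_K} × (φ ∘ α_K) : X_K × X_K × ∇X_K → X_K × X_K × A_μ`» (`α_K` the Albanese morphism (4.1),
  `D_K` the Hodge divisor Def. 4.22 (1)); meaningful for integral `φ`. -/
  step2 : ∀ K : Subgroup D.G, D.HomK K Dμ → CH3 K
  /-- ⟨CARRIER⟩ `(c₁, c₂, t) ↦ (c₁ ⊗ c₂ ⊗ t)^*`, the pull-back along the product correspondence on `X_K × X_K × A_μ` (Step 3,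
  p. 60 L1); total on `t : P.Chow` (`CH^{[M_μ:ℚ]/2}(A_μ × A_μ)_ℂ`), used in print only at `t = 𝕋^{can}_μ`, which has coefficients in
  `M_μ ⊆ 𝕃` (`P.ChowM`, Def. 4.9) so that the pull-back preserves `𝕃`-coefficients. -/
  corrPull : ∀ K : Subgroup D.G, S.CHXX K → S.CHXX K → P.Chow → (CH3 K →ₗ[L] CH3 K)
  /-- ⟨CARRIER⟩ `(u^{K'}_K × u^{K'}_K × id_{A_μ})^*` for `K' ⊆ K` (Lem. 4.29 (1)). -/
  pullLevel : ∀ K' K : Subgroup D.G, CH3 K →ₗ[L] CH3 K'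
  /-- ⟨CARRIER⟩ `(𝕋_g × 𝕋_g × id_{A_μ})^*`, `𝕋_g : X_{gKg⁻¹} → X_K` the Hecke translation (Lem. 4.29 (2)). -/
  pullHecke : ∀ (g : D.G) (K : Subgroup D.G), CH3 K →ₗ[L] CH3 (K.map (MulAut.conj g).toMonoidHom)
  /-- ⟨CARRIER⟩ `φ ↦ gφ = φ ∘ Alb(𝕋_g) ∈ Hom_E(A_{gKg⁻¹}, A_μ)_ℚ` (Lem. 4.29 (2) and its proof, p. 62 L9). -/
  gHom : ∀ (g : D.G) (K : Subgroup D.G), D.HomK K Dμ → D.HomK (K.map (MulAut.conj g).toMonoidHom) Dμ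
  /-- ⟨CARRIER⟩ `φ ↦ φ ∘ Alb(u^{K'}_K) ∈ Hom_E(A_{K'}, A_μ)_ℚ` for `K' ⊆ K` (implicit in Lem. 4.29 (1): `FJ(f₁,f₂;φ)_{K'}`). -/
  resHom : ∀ K' K : Subgroup D.G, D.HomK K Dμ → D.HomK K' Dμ
  /-- ⟨CARRIER⟩ `CH^{n−1+[M_μ:ℚ]/2}(X_∞ × X_∞ × A_μ)^0_𝕃 := colim_K CH^{n−1+[M_μ:ℚ]/2}(X_K × X_K × A_μ)^0_𝕃` (p. 62 L11–13). -/
  CHinf0 : ModuleCat.{0} L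
  /-- ⟨CARRIER⟩ `(g₁, g₂) ↦ (𝕋_{g₁} × 𝕋_{g₂} × id_{A_μ})^*` on `CH(X_∞ × X_∞ × A_μ)^0_𝕃`, `𝕋_g : X_∞ → X_∞` (Lem. 4.30). -/
  rhoInf0 : Representation L (D.G × D.G) CHinf0
  /-- ⟨CARRIER⟩ the canonical map `CH(X_K × X_K × A_μ)^0_𝕃 → CH(X_∞ × X_∞ × A_μ)^0_𝕃` into the colimit (p. 62 L11). -/
  toInf0 : ∀ K : Subgroup D.G, CH3zero K →ₗ[L] CHinf0
  /-- ⟨CARRIER⟩ `(f₁, f₂, φ) ↦ FJ(f₁,f₂;φ) ∈ CH^{n−1+[M_μ:ℚ]/2}(X_∞ × X_∞ × A_μ)^0_𝕃`, the «well-defined elements» of p. 62 L14–16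
  for `f₁, f₂ ∈ 𝓗_𝕃` and `φ ∈ Hom_E(A_∞, A_μ) ⊆ Ω(μ) = D.Ω` (Def. 4.16); tied to the level-`K` cycles by `FJinfWellDefined`. -/
  FJinf : (D.G → L) → (D.G → L) → D.Ω → CHinf0

namespace CycleData

variable {D : Liu2021.Thm418Data F E} {L : Subfield ℂ} {S : ShimuraData D L} {Dμ : D.Obj}
  {P : Sec41MotivesCMCharacters.ProjectorData D.isConjugateSymplectic D.hasWeight_one}
  (C : CycleData S Dμ P)

/-- **[Liu2021, Step 3, p. 60 L1–2] «`FJ(f₁,f₂;φ)_K := |π₀((X_K)_{E^{ac}})| · (𝕋_K^{f₁} ⊗ 𝕋_K^{f₂} ⊗ 𝕋^{can}_μ)^* (id_{X_K×X_K} ×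
(φ ∘ α_K))_* (Δ³X_K × D_K^{n−1})^∇` as an element in `CH^{n−1+[M_μ:ℚ]/2}(X_K × X_K × A_μ)_𝕃`»**, for test functions `f₁, f₂`,
an integral `φ ∈ Hom_E(A_K, A_μ)`, and `𝕋^{can}_μ = P.Tcan x` built from an `I_1`-generator `x` (Def. 4.9).  DEFINED over the
carriers. [cite: Liu2021, §4.3 Step 3 (p. 60 L1–2)] -/
def FJ (K : Subgroup D.G) (f₁ f₂ : D.G → L) (φ : D.HomK K Dμ) (x : P.IntegralElement) : C.CH3 K :=
  (S.numComp K : L) • C.corrPull K (S.T K f₁) (S.T K f₂) (P.Tcan x) (C.step2 K φ)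

/-- **`CH^i(X_K × X_K × A_μ)^♮_𝕃[i_μ]`** — «the subspace of `CH^i(X_K × X_K × A_μ)^♮_𝕃` on which `i_μ(M_μ)` acts via the inclusion
`M_μ ↪ 𝕃`» (p. 60 L6–7): the intersection over `x ∈ M_μ` of the `x`-eigenspaces of `actM K x`.  DEFINED.
[cite: Liu2021, §4.3 p. 60 L6–7] -/
def natIota (K : Subgroup D.G) : Submodule L (C.CH3nat K) :=
  ⨅ x : Liu2021.fieldOfValues E D.μ, Module.End.eigenspace (C.actM K x) (S.inclL x)

/-! ## Proposition 4.27 (p. 60; TeX l. 2507), Definition 4.28 (p. 61; l. 2540) -/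

section WithReps

variable {V₁ W₁ V₂ W₂ : Type} [AddCommGroup V₁] [Module ℂ V₁] [AddCommGroup W₁] [Module ℂ W₁]
  [AddCommGroup V₂] [Module ℂ V₂] [AddCommGroup W₂] [Module ℂ W₂]
  (Rel₁ Rel₂ : S.RelRep)
  (π₁ : Representation ℂ D.G V₁) (π₁d : Representation ℂ D.G W₁)
  (π₂ : Representation ℂ D.G V₂) (π₂d : Representation ℂ D.G W₂)

/-- **[Liu2021, Prop. 4.27 (1)] «The cycle `FJ(f₁,f₂;φ)_K` belongs to `CH^{n−1+[M_μ:ℚ]/2}(X_K × X_K × A_μ)^0_𝕃`»** (p. 60), under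
«the notation as above» (`NotationAsAbove`: `Π₁, Π₂` relevant, `(𝕍, π_i^∞) ∈ Φ_{Π_i}`, `π_i d = (π_i^∞)^∨`): `K` a level
subgroup, `f_i` test functions for `π_i^∞` (Def. 4.26), `φ` integral, `x` an `I_1`-generator.  Named fact; NO PROOF (printed proof:
Lem. 4.10). [cite: Liu2021, Prop. 4.27 (1) (p. 60)] -/
def Prop427_1AsPrinted : Prop :=
  S.NotationAsAbove Rel₁ Rel₂ π₁ π₁d π₂ π₂d →
  ∀ (K : Subgroup D.G), S.IsLevel K → ∀ (f₁ f₂ : D.G → L),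
    S.IsTestFunction K π₁ π₁d f₁ → S.IsTestFunction K π₂ π₂d f₂ →
      ∀ (φ : D.HomK K Dμ), C.IsIntegralHom K φ → ∀ (x : P.IntegralElement),
        P.IsGenerator (Sec41MotivesCMCharacters.I₁ D.μ) x → C.FJ K f₁ f₂ φ x ∈ C.CH3zero K

/-- **[Liu2021, Prop. 4.27 (2)] «The image of `FJ(f₁,f₂;φ)_K` in `CH^{n−1+[M_μ:ℚ]/2}(X_K × X_K × A_μ)^♮_𝕃` belongs to the
subspace `CH^{n−1+[M_μ:ℚ]/2}(X_K × X_K × A_μ)^♮_𝕃[i_μ]` and depends only on the homological equivalence class of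
`𝕋_K^{f₁} ⊗ 𝕋_K^{f₂}`»** (p. 60): for every witness `h` of (1), `toNat ⟨FJ, h⟩ ∈ CH^♮[i_μ]`, and two pairs of test functions with
homologically equivalent `𝕋^{f₁} ⊗ 𝕋^{f₂}` (`HomEquivTT`) give the same image.  Named fact; NO PROOF (printed proof pp. 60–61:
Prop. 4.25 (2) — whence the hypothesis `(𝕍, π_i^∞) ∈ Φ_{Π_i}` of `NotationAsAbove` — and the functoriality of `𝕋^{can}_μ`).
[cite: Liu2021, Prop. 4.27 (2) (p. 60)] -/
def Prop427_2AsPrinted : Prop :=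
  S.NotationAsAbove Rel₁ Rel₂ π₁ π₁d π₂ π₂d →
  ∀ (K : Subgroup D.G), S.IsLevel K → ∀ (f₁ f₂ : D.G → L),
    S.IsTestFunction K π₁ π₁d f₁ → S.IsTestFunction K π₂ π₂d f₂ →
      ∀ (φ : D.HomK K Dμ), C.IsIntegralHom K φ → ∀ (x : P.IntegralElement),
        P.IsGenerator (Sec41MotivesCMCharacters.I₁ D.μ) x →
          ∀ h : C.FJ K f₁ f₂ φ x ∈ C.CH3zero K,
            C.toNat K ⟨C.FJ K f₁ f₂ φ x, h⟩ ∈ C.natIota K ∧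
              ∀ (f₁' f₂' : D.G → L), S.IsTestFunction K π₁ π₁d f₁' → S.IsTestFunction K π₂ π₂d f₂' →
                S.HomEquivTT K f₁ f₂ f₁' f₂' → ∀ h' : C.FJ K f₁' f₂' φ x ∈ C.CH3zero K,
                  C.toNat K ⟨C.FJ K f₁' f₂' φ x, h'⟩ = C.toNat K ⟨C.FJ K f₁ f₂ φ x, h⟩

/-- **[Liu2021, Def. 4.28] «We call the image of `FJ(f₁,f₂;φ)_K` in `CH^{n−1+[M_μ:ℚ]/2}(X_K × X_K × A_μ)^♮_𝕃[i_μ]`, denoted by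
`FJ(f₁,f₂;φ)_K^♮`, a *natural Fourier–Jacobi cycle* for `Π₁ × Π₂ ⊗ μ`»** (p. 61; `FJ(f₁,f₂;φ)_K` itself is the *Fourier–Jacobi
cycle*, `CycleData.FJ`): the image under `CH^0 → CH^♮` of the cycle, GIVEN the membership `h` of Prop. 4.27 (1) (that it lies in
`CH^♮[i_μ]` is Prop. 4.27 (2)).  DEFINED. [cite: Liu2021, Def. 4.28 (p. 61)] -/
def FJnat (K : Subgroup D.G) (f₁ f₂ : D.G → L) (φ : D.HomK K Dμ) (x : P.IntegralElement)
    (h : C.FJ K f₁ f₂ φ x ∈ C.CH3zero K) : C.CH3nat K :=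
  C.toNat K ⟨C.FJ K f₁ f₂ φ x, h⟩

/-! ## Lemma 4.29 (p. 61; TeX l. 2548) -/

/-- **[Liu2021, Lem. 4.29 (1)] «Let `K' ⊆ K` be a smaller level subgroup. Then we have
`(u^{K'}_K × u^{K'}_K × id_{A_μ})^* FJ(f₁,f₂;φ)_K = FJ(f₁,f₂;φ)_{K'}`»** (p. 61), `φ ∈ Hom_E(A_K, A_μ)` regarded in
`Hom_E(A_{K'}, A_μ)` through `resHom`, under the standing notation of §4.3 (`NotationAsAbove`; `f₁, f₂ ∈ 𝓗_{K,𝕃}` test functions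
for `π₁^∞, π₂^∞`, Step 3) and the chosen `I_1`-generator `x`.  Named fact; NO PROOF (printed proof pp. 61–62).
[cite: Liu2021, Lem. 4.29 (1) (p. 61)] -/
def Lem429_1AsPrinted : Prop :=
  S.NotationAsAbove Rel₁ Rel₂ π₁ π₁d π₂ π₂d →
  ∀ (K' K : Subgroup D.G), S.IsLevel K → S.IsLevel K' → K' ≤ K →
    ∀ (f₁ f₂ : D.G → L), S.IsTestFunction K π₁ π₁d f₁ → S.IsTestFunction K π₂ π₂d f₂ →
      ∀ (φ : D.HomK K Dμ), C.IsIntegralHom K φ → ∀ (x : P.IntegralElement),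
        P.IsGenerator (Sec41MotivesCMCharacters.I₁ D.μ) x →
          C.pullLevel K' K (C.FJ K f₁ f₂ φ x) = C.FJ K' f₁ f₂ (C.resHom K' K φ) x

/-- **[Liu2021, Lem. 4.29 (2)] «For `g ∈ 𝔾(𝔸_F^∞)`, we have `(𝕋_g × 𝕋_g × id_{A_μ})^* FJ(f₁,f₂;φ)_K = FJ(R_g L_g f₁, R_g L_g f₂;
gφ)_{gKg⁻¹}`, where `𝕋_g : X_{gKg⁻¹} → X_K` is the Hecke translation»** (p. 61), under the standing notation of §4.3
(`NotationAsAbove`; `f₁, f₂ ∈ 𝓗_{K,𝕃}` test functions for `π₁^∞, π₂^∞`).  Named fact; NO PROOF (printed proof p. 62: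
`𝕋_g^* f_i = R_g L_g f_i`, `φ ∘ Alb_{𝕋_g} = gφ`, `|π₀(X_K)| = |π₀(X_{gKg⁻¹})|`). [cite: Liu2021, Lem. 4.29 (2) (p. 61)] -/
def Lem429_2AsPrinted : Prop :=
  S.NotationAsAbove Rel₁ Rel₂ π₁ π₁d π₂ π₂d →
  ∀ (g : D.G) (K : Subgroup D.G), S.IsLevel K →
    ∀ (f₁ f₂ : D.G → L), S.IsTestFunction K π₁ π₁d f₁ → S.IsTestFunction K π₂ π₂d f₂ →
      ∀ (φ : D.HomK K Dμ), C.IsIntegralHom K φ → ∀ (x : P.IntegralElement),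
        P.IsGenerator (Sec41MotivesCMCharacters.I₁ D.μ) x →
          C.pullHecke g K (C.FJ K f₁ f₂ φ x) =
            C.FJ (K.map (MulAut.conj g).toMonoidHom) (rightTranslate g (leftTranslate g f₁))
              (rightTranslate g (leftTranslate g f₂)) (C.gHom g K φ) x

/-! ## Infinite level (p. 62; TeX ll. 2586–2593) and Lemma 4.30 (p. 62; l. 2597) -/

/-- **[Liu2021, p. 62 L11–16] «The above lemma implies that we have well-defined elements
`FJ(f₁,f₂;φ) ∈ CH^{n−1+[M_μ:ℚ]/2}(X_∞ × X_∞ × A_μ)^0_𝕃`»**, under the standing notation of §4.3 (`NotationAsAbove`): for every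
level `K` at which `f₁, f₂ ∈ 𝓗_{K,𝕃}` are test functions for `π₁^∞, π₂^∞` and `φ ∈ Hom_E(A_K, A_μ)` is integral, and every witness `h`
that `FJ(f₁,f₂;φ)_K ∈ CH^0` (Prop. 4.27 (1)), the image of `FJ(f₁,f₂;φ)_K` in the colimit is `FJinf f₁ f₂ (res φ)`
(`D.res K D_μ : Hom_E(A_K,A_μ)_ℚ → Ω(μ)`, Thm. 4.18 (1)).  Named fact pinning the ⟨CARRIER⟩ `FJinf`; NO PROOF.
[cite: Liu2021, §4.3 p. 62 L11–16] -/
def FJinfWellDefined : Prop :=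
  S.NotationAsAbove Rel₁ Rel₂ π₁ π₁d π₂ π₂d →
  ∀ (K : Subgroup D.G), S.IsLevel K → ∀ (f₁ f₂ : D.G → L),
    S.IsTestFunction K π₁ π₁d f₁ → S.IsTestFunction K π₂ π₂d f₂ →
    ∀ (φ : D.HomK K Dμ), C.IsIntegralHom K φ → ∀ (x : P.IntegralElement),
      P.IsGenerator (Sec41MotivesCMCharacters.I₁ D.μ) x → ∀ h : C.FJ K f₁ f₂ φ x ∈ C.CH3zero K,
        C.toInf0 K ⟨C.FJ K f₁ f₂ φ x, h⟩ = C.FJinf f₁ f₂ (D.res K Dμ φ)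

/-- **[Liu2021, Lem. 4.30] «For every elements `g, g₁, g₂ ∈ 𝔾(𝔸_F^∞)`, we have
`FJ(R_{g₁} f₁, R_{g₂} f₂; φ) = (𝕋_{g₁} × 𝕋_{g₂} × id_{A_μ})^* FJ(f₁,f₂;φ)`, `FJ(L_g f₁, L_g f₂; gφ) = FJ(f₁,f₂;φ)`, where
`𝕋_g : X_∞ → X_∞` denotes the Hecke translation by `g`»** (p. 62), under the standing notation of §4.3 (`NotationAsAbove`), for
the test functions `f₁, f₂` (for `π₁^∞, π₂^∞`, at some level `K`, Step 3) and `φ ∈ Ω(μ)` the image of an integral `φ ∈ Hom_E(A_K, A_μ)`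
(`gφ` = `D.rhoΩ g φ`, the action of `G` on `Ω(μ)`, Def. 4.16; `FJinf` is the ⟨CARRIER⟩ `(f₁, f₂, φ) ↦ FJ(f₁,f₂;φ)` on `𝓗_𝕃 × 𝓗_𝕃 × Ω(μ)`,
on which print evaluates `FJ(R_{g₁} f₁, R_{g₂} f₂; φ)`).  Named fact; NO PROOF (printed proof pp. 62–63 from Lem. 4.29 (2)).
[cite: Liu2021, Lem. 4.30 (p. 62)] -/
def Lem430AsPrinted : Prop :=
  S.NotationAsAbove Rel₁ Rel₂ π₁ π₁d π₂ π₂d →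
  ∀ (g g₁ g₂ : D.G) (K : Subgroup D.G), S.IsLevel K → ∀ (f₁ f₂ : D.G → L),
    S.IsTestFunction K π₁ π₁d f₁ → S.IsTestFunction K π₂ π₂d f₂ →
    ∀ φ : D.Ω, (∃ ψ : D.HomK K Dμ, C.IsIntegralHom K ψ ∧ D.res K Dμ ψ = φ) →
      C.FJinf (rightTranslate g₁ f₁) (rightTranslate g₂ f₂) φ = C.rhoInf0 (g₁, g₂) (C.FJinf f₁ f₂ φ) ∧
        C.FJinf (leftTranslate g f₁) (leftTranslate g f₂) (D.rhoΩ g φ) = C.FJinf f₁ f₂ φ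

end WithReps

end CycleData

end Literature.NumberTheory.Automorphic.Liu2021.Sec43FourierJacobiCycles

end
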